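import Summits.AtomisticToContinuum.Crystallization.Theorems.ExcessDecayLiouvilleHcpLiouvilleSiteSums

/-!
# `ExcessDecayLiouville.HcpLiouville` (stmt-AtomisticToContinuum-9332), line `Sketch`: the commutator weights are `O(1/R)`

Step (6) of stub `stub_flatDifferences` (level 2 of the two-level Caccioppoli argument): the partial sums
of the commutator weights `M(p,q) = (χ p − χ q)² (dist p q)⁻⁸ ‖w p‖²` of the linear Caccioppoli inequality
(`χ` the radial cut-off of `…HcpLiouvilleSiteSums` at centre `c` and radius `R ≥ 1`, `w` a field on the
sites `S = Sites₀ t A` with `‖w‖ ≤ 1/20` and `ℓ²(B_{R'})`-growth `Σ_{B_{R'}} ‖w‖² ≤ C_w R'`) are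
`≤ (3·K₆·C_w + 600)/R`, `K₆ = 1024·(25/23)⁶`:

* rows at sites `p ∈ B_{3R}(c)`: `(χ p − χ q)² ≤ dist p q²/R²` and `Σ_{q ≠ p} dist p q⁻⁶ ≤ K₆`, then the growth
  bound on `B_{3R}(c)`;
* rows at sites `p ∉ B_{3R}(c)`: `χ p = 0`, only `q ∈ B_{2R}(c)` contribute, at distance `≥ R`, so after
  exchanging the two finite sums the far-field bound `Σ_{p : dist ≥ R} dist⁻⁸ ≤ 1024(25/23)³R⁻⁵` and the
  packing count `#(S ∩ B_{2R}) ≤ (100R/23 + 1)³` give `≤ 600/R²`.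

Also `flatDiff_nnForm_ge_pair`: one nearest-neighbour bond is dominated by the strain form `nnForm`.
All `[folklore]`; a `--supports` helper for item stmt-AtomisticToContinuum-9332, nothing here closes an
item.
-/

noncomputable section

namespace Summit.AtomisticToContinuum.Crystallization.Theorems.ExcessDecayLiouville

open scoped BigOperators Topology Classical InnerProductSpace
open Literature.MathematicalPhysics.StatisticalMechanics
open Summit.AtomisticToContinuum.Crystallization.Theses.ExcessDecayLiouville
open Summit.AtomisticToContinuum.Crystallization.Theorems.PhononStabilityNegative

section Weights

variable {t : Fin 2 → (EuclideanSpace ℝ (Fin 3))} {A : (EuclideanSpace ℝ (Fin 3)) →L[ℝ] (EuclideanSpace ℝ (Fin 3))} {w : (EuclideanSpace ℝ (Fin 3)) → (EuclideanSpace ℝ (Fin 3))} {c : (EuclideanSpace ℝ (Fin 3))} {R Cw : ℝ}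


/-- Rows of the commutator weights at ANY site: `Σ_q (χ p − χ q)² (dist p q)⁻⁸ ≤ K₆/R²`. [folklore] -/
private theorem weightRow_le (hA : Adm₀ A) (hI : Inner₀ t A) (hR : 1 ≤ R) (p : Sites₀ t A)
    (U₂ : Finset (Sites₀ t A)) :
    ∑ q ∈ U₂, (if (p : (EuclideanSpace ℝ (Fin 3))) ≠ q then ((max 0 (min 1 (2 - dist (p : (EuclideanSpace ℝ (Fin 3))) c / R))) - (max 0 (min 1 (2 - dist (q : (EuclideanSpace ℝ (Fin 3))) c / R)))) ^ 2 * (dist (p : (EuclideanSpace ℝ (Fin 3))) q)⁻¹ ^ 8 else 0) ≤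
      1024 / ((23 / 25) ^ 3 * (23 / 25) ^ 3) / R ^ 2 := by
  have hR0 : 0 < R := by linarith
  have hle : ∀ q ∈ U₂, (if (p : (EuclideanSpace ℝ (Fin 3))) ≠ q then ((max 0 (min 1 (2 - dist (p : (EuclideanSpace ℝ (Fin 3))) c / R))) - (max 0 (min 1 (2 - dist (q : (EuclideanSpace ℝ (Fin 3))) c / R)))) ^ 2 * (dist (p : (EuclideanSpace ℝ (Fin 3))) q)⁻¹ ^ 8 else 0) ≤
      (if (p : (EuclideanSpace ℝ (Fin 3))) ≠ q then (dist (p : (EuclideanSpace ℝ (Fin 3))) q)⁻¹ ^ (3 + 3) else 0) / R ^ 2 := by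
    intro q _
    by_cases hpq : (p : (EuclideanSpace ℝ (Fin 3))) ≠ q
    · rw [if_pos hpq, if_pos hpq]
      have hd : 0 < dist (p : (EuclideanSpace ℝ (Fin 3))) q := dist_pos.2 hpq
      have hχ := flatDiff_cutoff_sub_sq_le (c := c) hR0 (p : (EuclideanSpace ℝ (Fin 3))) q
      have hid : dist (p : (EuclideanSpace ℝ (Fin 3))) q ^ 2 / R ^ 2 * (dist (p : (EuclideanSpace ℝ (Fin 3))) q)⁻¹ ^ 8 =
          (dist (p : (EuclideanSpace ℝ (Fin 3))) q)⁻¹ ^ (3 + 3) / R ^ 2 := by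
        show _ = (dist (p : (EuclideanSpace ℝ (Fin 3))) q)⁻¹ ^ 6 / R ^ 2
        field_simp
      calc ((max 0 (min 1 (2 - dist (p : (EuclideanSpace ℝ (Fin 3))) c / R))) - (max 0 (min 1 (2 - dist (q : (EuclideanSpace ℝ (Fin 3))) c / R)))) ^ 2 * (dist (p : (EuclideanSpace ℝ (Fin 3))) q)⁻¹ ^ 8
          ≤ dist (p : (EuclideanSpace ℝ (Fin 3))) q ^ 2 / R ^ 2 * (dist (p : (EuclideanSpace ℝ (Fin 3))) q)⁻¹ ^ 8 := by gcongr
        _ = _ := hid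
    · rw [if_neg hpq, if_neg hpq, zero_div]
  calc _ ≤ ∑ q ∈ U₂, (if (p : (EuclideanSpace ℝ (Fin 3))) ≠ q then (dist (p : (EuclideanSpace ℝ (Fin 3))) q)⁻¹ ^ (3 + 3) else 0) / R ^ 2 :=
        Finset.sum_le_sum hle
    _ = (∑ q ∈ U₂, (if (p : (EuclideanSpace ℝ (Fin 3))) ≠ q then (dist (p : (EuclideanSpace ℝ (Fin 3))) q)⁻¹ ^ (3 + 3) else 0)) / R ^ 2 := by
        rw [Finset.sum_div]
    _ ≤ _ := by gcongr; exact flatDiff_sum_inv_pow_sites_le hA hI p.2 (by norm_num) U₂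

/-- Entries of the commutator weights at a FAR site `p ∉ B_{3R}(c)`: only `q ∈ B_{2R}(c)` contribute, at
distance `≥ R`. [folklore] -/
private theorem weight_far_le (hR : 1 ≤ R) (hw : ∀ s ∈ Sites₀ t A, ‖w s‖ ≤ 1 / 20) (p q : Sites₀ t A)
    (hp : 3 * R < dist (p : (EuclideanSpace ℝ (Fin 3))) c) :
    (if (p : (EuclideanSpace ℝ (Fin 3))) ≠ q then ((max 0 (min 1 (2 - dist (p : (EuclideanSpace ℝ (Fin 3))) c / R))) - (max 0 (min 1 (2 - dist (q : (EuclideanSpace ℝ (Fin 3))) c / R)))) ^ 2 * (dist (p : (EuclideanSpace ℝ (Fin 3))) q)⁻¹ ^ 8 * ‖w p‖ ^ 2 else 0) ≤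
      1 / 400 * (if dist (q : (EuclideanSpace ℝ (Fin 3))) c ≤ 2 * R then
        (if R ≤ dist (q : (EuclideanSpace ℝ (Fin 3))) p then (dist (q : (EuclideanSpace ℝ (Fin 3))) p)⁻¹ ^ (5 + 3) else 0) else 0) := by
  have hR0 : 0 < R := by linarith
  have hχp : (max 0 (min 1 (2 - dist (p : (EuclideanSpace ℝ (Fin 3))) c / R))) = 0 := flatDiff_cutoff_eq_zero hR0 (by linarith)
  by_cases hpq : (p : (EuclideanSpace ℝ (Fin 3))) ≠ q
  · rw [if_pos hpq, hχp, zero_sub, neg_sq]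
    by_cases hq : dist (q : (EuclideanSpace ℝ (Fin 3))) c ≤ 2 * R
    · have hdist : R ≤ dist (q : (EuclideanSpace ℝ (Fin 3))) p := by
        have := dist_triangle (p : (EuclideanSpace ℝ (Fin 3))) q c
        rw [dist_comm (q : (EuclideanSpace ℝ (Fin 3))) p]
        linarith
      rw [if_pos hq, if_pos hdist, dist_comm (q : (EuclideanSpace ℝ (Fin 3))) p]
      have hχq : (max 0 (min 1 (2 - dist (q : (EuclideanSpace ℝ (Fin 3))) c / R))) ^ 2 ≤ 1 := by
        have h0 := flatDiff_cutoff_nonneg c R (q : (EuclideanSpace ℝ (Fin 3)))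
        have h1 := flatDiff_cutoff_le_one c R (q : (EuclideanSpace ℝ (Fin 3)))
        nlinarith
      have hW : ‖w p‖ ^ 2 ≤ 1 / 400 := by
        have h := hw p p.2
        have h0 := norm_nonneg (w p)
        nlinarith
      have h8 : (0 : ℝ) ≤ (dist (p : (EuclideanSpace ℝ (Fin 3))) q)⁻¹ ^ 8 := by positivity
      calc (max 0 (min 1 (2 - dist (q : (EuclideanSpace ℝ (Fin 3))) c / R))) ^ 2 * (dist (p : (EuclideanSpace ℝ (Fin 3))) q)⁻¹ ^ 8 * ‖w p‖ ^ 2 ≤ 1 * (dist (p : (EuclideanSpace ℝ (Fin 3))) q)⁻¹ ^ 8 * (1 / 400) := by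
            gcongr
        _ = _ := by ring
    · have hχq : (max 0 (min 1 (2 - dist (q : (EuclideanSpace ℝ (Fin 3))) c / R))) = 0 := flatDiff_cutoff_eq_zero hR0 (by linarith [not_le.1 hq])
      rw [if_neg hq, hχq]
      simp
  · rw [if_neg hpq]
    positivity

/-- **Packing count**: at most `(2·R'/(23/25) + 1)³` sites in a closed ball of radius `R' ≥ 0`. [folklore] -/
private theorem card_sites_ball_le (hA : Adm₀ A) (hI : Inner₀ t A) (x : (EuclideanSpace ℝ (Fin 3))) {R' : ℝ} (hR' : 0 ≤ R')
    (U : Finset (Sites₀ t A)) (hU : ∀ q ∈ U, dist (q : (EuclideanSpace ℝ (Fin 3))) x ≤ R') :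
    (U.card : ℝ) ≤ (2 * R' / (23 / 25) + 1) ^ 3 := by
  have h := card_le_of_separated_of_dist_le (U.map (Function.Embedding.subtype _)) x
    (by norm_num : (0 : ℝ) < 23 / 25) hR' ?_ ?_
  · rwa [Finset.card_map, finrank_euclideanSpace_fin] at h
  · intro a ha
    simp only [Finset.mem_map, Function.Embedding.coe_subtype] at ha
    obtain ⟨a', ha', rfl⟩ := ha
    exact hU a' ha'
  · intro a ha b hb hab
    simp only [Finset.mem_map, Function.Embedding.coe_subtype] at ha hb
    obtain ⟨a', -, rfl⟩ := ha
    obtain ⟨b', -, rfl⟩ := hb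
    exact dist_sites_ge hA hI a'.2 b'.2 hab

/-- The far rows together contribute `≤ 600/R²`. [folklore] -/
private theorem weights_far_le (hA : Adm₀ A) (hI : Inner₀ t A) (hR : 1 ≤ R) (hw : ∀ s ∈ Sites₀ t A, ‖w s‖ ≤ 1 / 20)
    (U₁ U₂ : Finset (Sites₀ t A)) (hU₁ : ∀ p ∈ U₁, 3 * R < dist (p : (EuclideanSpace ℝ (Fin 3))) c) :
    ∑ p ∈ U₁, ∑ q ∈ U₂,
      (if (p : (EuclideanSpace ℝ (Fin 3))) ≠ q then ((max 0 (min 1 (2 - dist (p : (EuclideanSpace ℝ (Fin 3))) c / R))) - (max 0 (min 1 (2 - dist (q : (EuclideanSpace ℝ (Fin 3))) c / R)))) ^ 2 * (dist (p : (EuclideanSpace ℝ (Fin 3))) q)⁻¹ ^ 8 * ‖w p‖ ^ 2 else 0) ≤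
      600 / R ^ 2 := by
  have hR0 : 0 < R := by linarith
  -- exchange the sums after the pointwise bound
  have h1 : ∑ p ∈ U₁, ∑ q ∈ U₂,
      (if (p : (EuclideanSpace ℝ (Fin 3))) ≠ q then ((max 0 (min 1 (2 - dist (p : (EuclideanSpace ℝ (Fin 3))) c / R))) - (max 0 (min 1 (2 - dist (q : (EuclideanSpace ℝ (Fin 3))) c / R)))) ^ 2 * (dist (p : (EuclideanSpace ℝ (Fin 3))) q)⁻¹ ^ 8 * ‖w p‖ ^ 2 else 0) ≤
      ∑ q ∈ U₂, (1 / 400 * (if dist (q : (EuclideanSpace ℝ (Fin 3))) c ≤ 2 * R then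
        ∑ p ∈ U₁, (if R ≤ dist (q : (EuclideanSpace ℝ (Fin 3))) p then (dist (q : (EuclideanSpace ℝ (Fin 3))) p)⁻¹ ^ (5 + 3) else 0) else 0)) := by
    calc _ ≤ ∑ p ∈ U₁, ∑ q ∈ U₂, 1 / 400 * (if dist (q : (EuclideanSpace ℝ (Fin 3))) c ≤ 2 * R then
          (if R ≤ dist (q : (EuclideanSpace ℝ (Fin 3))) p then (dist (q : (EuclideanSpace ℝ (Fin 3))) p)⁻¹ ^ (5 + 3) else 0) else 0) :=
          Finset.sum_le_sum fun p hp => Finset.sum_le_sum fun q _ => weight_far_le hR hw p q (hU₁ p hp)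
      _ = _ := by
          rw [Finset.sum_comm]
          refine Finset.sum_congr rfl fun q _ => ?_
          rw [← Finset.mul_sum]
          congr 1
          split_ifs
          · rfl
          · simp
  -- the inner far-field sums
  have h2 : ∀ q ∈ U₂, (1 / 400 * (if dist (q : (EuclideanSpace ℝ (Fin 3))) c ≤ 2 * R then
      ∑ p ∈ U₁, (if R ≤ dist (q : (EuclideanSpace ℝ (Fin 3))) p then (dist (q : (EuclideanSpace ℝ (Fin 3))) p)⁻¹ ^ (5 + 3) else 0) else 0)) ≤
      (if dist (q : (EuclideanSpace ℝ (Fin 3))) c ≤ 2 * R then 1 / 400 * (1024 / ((23 / 25) ^ 3 * R ^ 5)) else 0) := by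
    intro q _
    split_ifs
    · have h := flatDiff_sum_inv_pow_sites_far_le hA hI (q : (EuclideanSpace ℝ (Fin 3))) (by linarith : (23 : ℝ) / 25 ≤ R)
        (show 1 ≤ 5 by norm_num) U₁
      linarith
    · simp
  -- the packing count
  have h3 : ∑ q ∈ U₂, (if dist (q : (EuclideanSpace ℝ (Fin 3))) c ≤ 2 * R then 1 / 400 * (1024 / ((23 / 25) ^ 3 * R ^ 5)) else 0)
      ≤ (2 * (2 * R) / (23 / 25) + 1) ^ 3 * (1 / 400 * (1024 / ((23 / 25) ^ 3 * R ^ 5))) := by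
    rw [← Finset.sum_filter, Finset.sum_const, nsmul_eq_mul]
    refine mul_le_mul_of_nonneg_right ?_ (by positivity)
    exact card_sites_ball_le hA hI c (by positivity) _ fun q hq => (Finset.mem_filter.1 hq).2
  -- arithmetic
  have h4 : (2 * (2 * R) / (23 / 25) + 1) ^ 3 * (1 / 400 * (1024 / ((23 / 25) ^ 3 * R ^ 5))) ≤
      600 / R ^ 2 := by
    have hb : 2 * (2 * R) / (23 / 25) + 1 ≤ 123 / 23 * R := by
      rw [div_add_one (by norm_num), div_le_iff₀ (by norm_num)]; nlinarith
    have hb3 : (2 * (2 * R) / (23 / 25) + 1) ^ 3 ≤ (123 / 23 * R) ^ 3 :=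
      pow_le_pow_left₀ (by positivity) hb 3
    calc _ ≤ (123 / 23 * R) ^ 3 * (1 / 400 * (1024 / ((23 / 25) ^ 3 * R ^ 5))) := by gcongr
      _ = (123 / 23) ^ 3 * (1 / 400) * 1024 / (23 / 25) ^ 3 / R ^ 2 := by
          field_simp
      _ ≤ 600 / R ^ 2 := by gcongr; norm_num
  exact h1.trans ((Finset.sum_le_sum h2).trans (h3.trans h4))

/-- **The commutator weights are `O(1/R)`**: if `‖w‖ ≤ 1/20` on the sites and
`Σ_{p ∈ U} ‖w p‖² ≤ C_w·R'` for finite sets `U` of sites in balls `B_{R'}`, `R' ≥ 1`, then for `R ≥ 1`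
every partial sum of `(χ p − χ q)² (dist p q)⁻⁸ ‖w p‖²` over `↥S × ↥S` is
`≤ (3·(1024(25/23)⁶)·C_w + 600)/R`. [folklore] -/
theorem flatDiff_weights_partial_sum_le (hA : Adm₀ A) (hI : Inner₀ t A) (hR : 1 ≤ R)
    (hw : ∀ s ∈ Sites₀ t A, ‖w s‖ ≤ 1 / 20)
    (hW : ∀ (c' : (EuclideanSpace ℝ (Fin 3))) (R' : ℝ), 1 ≤ R' → ∀ U : Finset (Sites₀ t A),
      (∀ p ∈ U, dist (p : (EuclideanSpace ℝ (Fin 3))) c' ≤ R') → ∑ p ∈ U, ‖w p‖ ^ 2 ≤ Cw * R')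
    (U : Finset (Sites₀ t A × Sites₀ t A)) :
    ∑ pq ∈ U, (if (pq.1 : (EuclideanSpace ℝ (Fin 3))) ≠ pq.2 then
      ((max 0 (min 1 (2 - dist (pq.1 : (EuclideanSpace ℝ (Fin 3))) c / R))) - (max 0 (min 1 (2 - dist (pq.2 : (EuclideanSpace ℝ (Fin 3))) c / R)))) ^ 2 * (dist (pq.1 : (EuclideanSpace ℝ (Fin 3))) pq.2)⁻¹ ^ 8 * ‖w pq.1‖ ^ 2 else 0) ≤
      (3 * (1024 / ((23 / 25) ^ 3 * (23 / 25) ^ 3)) * Cw + 600) / R := by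
  classical
  have hR0 : 0 < R := by linarith
  set M : Sites₀ t A → Sites₀ t A → ℝ := fun p q => if (p : (EuclideanSpace ℝ (Fin 3))) ≠ q then
    ((max 0 (min 1 (2 - dist (p : (EuclideanSpace ℝ (Fin 3))) c / R))) - (max 0 (min 1 (2 - dist (q : (EuclideanSpace ℝ (Fin 3))) c / R)))) ^ 2 * (dist (p : (EuclideanSpace ℝ (Fin 3))) q)⁻¹ ^ 8 * ‖w p‖ ^ 2 else 0 with hMdef
  have hM0 : ∀ p q, 0 ≤ M p q := fun p q => by simp only [hMdef]; split_ifs <;> positivity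
  set U₁ := U.image Prod.fst with hU₁
  set U₂ := U.image Prod.snd with hU₂
  -- reduce to a product of finite sets and split the rows
  have h1 : ∑ pq ∈ U, M pq.1 pq.2 ≤ ∑ p ∈ U₁, ∑ q ∈ U₂, M p q := by
    rw [← Finset.sum_product (f := fun pq => M pq.1 pq.2)]
    exact Finset.sum_le_sum_of_subset_of_nonneg Finset.subset_product (fun pq _ _ => hM0 _ _)
  rw [← Finset.sum_filter_add_sum_filter_not U₁ (fun p : Sites₀ t A => dist (p : (EuclideanSpace ℝ (Fin 3))) c ≤ 3 * R)] at h1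
  -- near rows
  have hnear : ∑ p ∈ U₁.filter (fun p : Sites₀ t A => dist (p : (EuclideanSpace ℝ (Fin 3))) c ≤ 3 * R), ∑ q ∈ U₂, M p q ≤
      3 * (1024 / ((23 / 25) ^ 3 * (23 / 25) ^ 3)) * Cw / R := by
    have hrow : ∀ p ∈ U₁.filter (fun p : Sites₀ t A => dist (p : (EuclideanSpace ℝ (Fin 3))) c ≤ 3 * R), ∑ q ∈ U₂, M p q ≤
        ‖w p‖ ^ 2 * (1024 / ((23 / 25) ^ 3 * (23 / 25) ^ 3) / R ^ 2) := by
      intro p _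
      have h := weightRow_le (c := c) hA hI hR p U₂
      have heq : ∑ q ∈ U₂, M p q = ‖w p‖ ^ 2 *
          ∑ q ∈ U₂, (if (p : (EuclideanSpace ℝ (Fin 3))) ≠ q then ((max 0 (min 1 (2 - dist (p : (EuclideanSpace ℝ (Fin 3))) c / R))) - (max 0 (min 1 (2 - dist (q : (EuclideanSpace ℝ (Fin 3))) c / R)))) ^ 2 * (dist (p : (EuclideanSpace ℝ (Fin 3))) q)⁻¹ ^ 8 else 0) := by
        rw [Finset.mul_sum]
        refine Finset.sum_congr rfl fun q _ => ?_
        simp only [hMdef]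
        split_ifs
        · ring
        · ring
      rw [heq]
      exact mul_le_mul_of_nonneg_left h (sq_nonneg _)
    have hsumW : ∑ p ∈ U₁.filter (fun p : Sites₀ t A => dist (p : (EuclideanSpace ℝ (Fin 3))) c ≤ 3 * R), ‖w p‖ ^ 2 ≤
        Cw * (3 * R) :=
      hW c (3 * R) (by linarith) _ fun p hp => (Finset.mem_filter.1 hp).2
    calc _ ≤ ∑ p ∈ U₁.filter (fun p : Sites₀ t A => dist (p : (EuclideanSpace ℝ (Fin 3))) c ≤ 3 * R),
          ‖w p‖ ^ 2 * (1024 / ((23 / 25) ^ 3 * (23 / 25) ^ 3) / R ^ 2) := Finset.sum_le_sum hrow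
      _ = (∑ p ∈ U₁.filter (fun p : Sites₀ t A => dist (p : (EuclideanSpace ℝ (Fin 3))) c ≤ 3 * R), ‖w p‖ ^ 2) *
          (1024 / ((23 / 25) ^ 3 * (23 / 25) ^ 3) / R ^ 2) := by rw [Finset.sum_mul]
      _ ≤ Cw * (3 * R) * (1024 / ((23 / 25) ^ 3 * (23 / 25) ^ 3) / R ^ 2) :=
          mul_le_mul_of_nonneg_right hsumW (by positivity)
      _ = 3 * (1024 / ((23 / 25) ^ 3 * (23 / 25) ^ 3)) * Cw / R := by
          field_simp
  -- far rows
  have hfar : ∑ p ∈ U₁.filter (fun p : Sites₀ t A => ¬ dist (p : (EuclideanSpace ℝ (Fin 3))) c ≤ 3 * R), ∑ q ∈ U₂, M p q ≤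
      600 / R := by
    have h := weights_far_le (c := c) hA hI hR hw
      (U₁.filter fun p : Sites₀ t A => ¬ dist (p : (EuclideanSpace ℝ (Fin 3))) c ≤ 3 * R) U₂
      fun p hp => not_le.1 (Finset.mem_filter.1 hp).2
    have h600 : (600 : ℝ) / R ^ 2 ≤ 600 / R := by
      rw [div_le_div_iff_of_pos_left (by norm_num) (by positivity) hR0]
      nlinarith
    exact h.trans h600
  calc ∑ pq ∈ U, M pq.1 pq.2 ≤ _ := h1
    _ ≤ 3 * (1024 / ((23 / 25) ^ 3 * (23 / 25) ^ 3)) * Cw / R + 600 / R := add_le_add hnear hfar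
    _ = _ := by rw [add_div]

/-- Registered form of `flatDiff_weights_partial_sum_le` (sub-goal of crux stmt-AtomisticToContinuum-9332, line
`Sketch`): the commutator weights of the linear Caccioppoli inequality are `O(1/R)`. [folklore] -/
theorem hcpLiouville_weights_partial_sum_le : ∀ (t : Fin 2 → (EuclideanSpace ℝ (Fin 3))) (A : (EuclideanSpace ℝ (Fin 3)) →L[ℝ] (EuclideanSpace ℝ (Fin 3))) (w : (EuclideanSpace ℝ (Fin 3)) → (EuclideanSpace ℝ (Fin 3))) (c : (EuclideanSpace ℝ (Fin 3))) (R Cw : ℝ), Adm₀ A → Inner₀ t A → 1 ≤ R → (∀ s ∈ Sites₀ t A, ‖w s‖ ≤ 1 / 20) → (∀ (c' : (EuclideanSpace ℝ (Fin 3))) (R' : ℝ), 1 ≤ R' → ∀ U : Finset (Sites₀ t A), (∀ p ∈ U, dist (p : (EuclideanSpace ℝ (Fin 3))) c' ≤ R') → ∑ p ∈ U, ‖w p‖ ^ 2 ≤ Cw * R') → ∀ U : Finset (Sites₀ t A × Sites₀ t A), ∑ pq ∈ U, (if (pq.1 : (EuclideanSpace ℝ (Fin 3))) ≠ pq.2 then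 (max 0 (min 1 (2 - dist (pq.1 : (EuclideanSpace ℝ (Fin 3))) c / R)) - max 0 (min 1 (2 - dist (pq.2 : (EuclideanSpace ℝ (Fin 3))) c / R))) ^ 2 * (dist (pq.1 : (EuclideanSpace ℝ (Fin 3))) pq.2)⁻¹ ^ 8 * ‖w pq.1‖ ^ 2 else 0) ≤ (3 * (1024 / ((23 / 25) ^ 3 * (23 / 25) ^ 3)) * Cw + 600) / R := by
  intro t A w c R Cw hA hI hR hw hW U
  exact flatDiff_weights_partial_sum_le hA hI hR hw hW U

end Weights

/-! ## One bond is dominated by the strain form -/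

/-- **One nearest-neighbour bond is dominated by `nnForm`**: for a finitely supported field `φ` and
sites `p₀, q₀` at distance `≤ 11/10`, `‖φ p₀ − φ q₀‖² ≤ nnForm t A φ`. [folklore] -/
theorem flatDiff_nnForm_ge_pair {t : Fin 2 → (EuclideanSpace ℝ (Fin 3))} {A : (EuclideanSpace ℝ (Fin 3)) →L[ℝ] (EuclideanSpace ℝ (Fin 3))} (hA : Adm₀ A) (hI : Inner₀ t A)
    (φ : (EuclideanSpace ℝ (Fin 3)) → (EuclideanSpace ℝ (Fin 3))) (hfin : (Function.support φ).Finite) {p₀ q₀ : (EuclideanSpace ℝ (Fin 3))} (hp₀ : p₀ ∈ Sites₀ t A)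
    (hq₀ : q₀ ∈ Sites₀ t A) (hd : dist p₀ q₀ ≤ 11 / 10) :
    ‖φ p₀ - φ q₀‖ ^ 2 ≤ nnForm t A φ := by
  set N : Sites₀ t A → Sites₀ t A → ℝ := fun p q =>
    if dist (p : (EuclideanSpace ℝ (Fin 3))) q ≤ 11 / 10 then ‖φ p - φ q‖ ^ 2 else 0 with hN
  have hN0 : ∀ p q, 0 ≤ N p q := fun p q => by simp only [hN]; split_ifs <;> positivity
  -- summability over `↥S × ↥S`
  set F : Finset (Sites₀ t A) := (hfin.preimage Subtype.val_injective.injOn).toFinset with hF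
  have hF0 : ∀ p : Sites₀ t A, p ∉ F → φ p = 0 := by
    intro p hp
    by_contra h
    exact hp ((Set.Finite.mem_toFinset _).2 h)
  have hrowfin : ∀ (p : Sites₀ t A) (C : ℝ), Summable fun q : Sites₀ t A =>
      if dist (p : (EuclideanSpace ℝ (Fin 3))) q ≤ 11 / 10 then C else 0 := by
    intro p C
    refine summable_of_ne_finset_zero (s := (flatDiff_finite_sites_ball hA hI (p : (EuclideanSpace ℝ (Fin 3))) (11 / 10)).toFinset) ?_
    intro q hq
    rw [if_neg]
    intro hle
    exact hq ((Set.Finite.mem_toFinset _).2 (by simpa [dist_comm] using hle))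
  have hS₁ : Summable (Function.uncurry fun p q : Sites₀ t A =>
      if dist (p : (EuclideanSpace ℝ (Fin 3))) q ≤ 11 / 10 then 2 * ‖φ p‖ ^ 2 else 0) :=
    flatDiff_summable_uncurry_of_left_finset _ F (fun p hp q => by simp [hF0 p hp]) fun p _ => hrowfin p _
  have hS₂ : Summable (Function.uncurry fun p q : Sites₀ t A =>
      if dist (p : (EuclideanSpace ℝ (Fin 3))) q ≤ 11 / 10 then 2 * ‖φ q‖ ^ 2 else 0) := by
    refine flatDiff_summable_uncurry_of_right_finset _ F (fun q hq p => by simp [hF0 q hq]) fun q _ => ?_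
    have h := hrowfin q (2 * ‖φ q‖ ^ 2)
    refine h.congr fun p => ?_
    rw [dist_comm]
  have hUS : Summable (Function.uncurry N) := by
    refine Summable.of_nonneg_of_le (fun pq => hN0 pq.1 pq.2) (fun pq => ?_) (hS₁.add hS₂)
    obtain ⟨p, q⟩ := pq
    simp only [Function.uncurry_apply_pair, hN]
    split_ifs
    · have h := parallelogram_law_with_norm ℝ (φ p) (φ q)
      nlinarith [sq_nonneg ‖φ p + φ q‖]
    · simp
  -- extract the term `(p₀, q₀)`
  have houter : Summable fun p : Sites₀ t A => ∑' q : Sites₀ t A, N p q := hUS.prod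
  have h1 : ∑' q : Sites₀ t A, N ⟨p₀, hp₀⟩ q ≤ nnForm t A φ :=
    houter.le_tsum ⟨p₀, hp₀⟩ fun p _ => tsum_nonneg fun q => hN0 p q
  have h2 : N ⟨p₀, hp₀⟩ ⟨q₀, hq₀⟩ ≤ ∑' q : Sites₀ t A, N ⟨p₀, hp₀⟩ q :=
    (hUS.prod_factor ⟨p₀, hp₀⟩).le_tsum ⟨q₀, hq₀⟩ fun q _ => hN0 _ q
  have h3 : N ⟨p₀, hp₀⟩ ⟨q₀, hq₀⟩ = ‖φ p₀ - φ q₀‖ ^ 2 := by simp only [hN, if_pos hd]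
  linarith

end Summit.AtomisticToContinuum.Crystallization.Theorems.ExcessDecayLiouville

end
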